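import Literature.NumberTheory.LFunctions.LiouvilleSumClassicalBound
import Literature.NumberTheory.Sieve.CoprimeSquarefreeSums
import Literature.NumberTheory.Sieve.SieveFrameworkProofs
import HarnessLib

/-!
# The identity behind the certified evaluation of Turán's sum `T(N) = ∑_{k ≤ N} λ(k)/k`

Barrier catalogue `Literature/Barriers/RiemannHypothesis/`, support file for the discharge of
`Literature.Barriers.RiemannHypothesis.BFM2008_thm1_minWitness` (`T(72 204 113 780 255) < 0`,
Borwein–Ferguson–Mossinghoff 2008, Thm. 1). Pure mathematics (finite sums), no computation:
with `T(n) = ∑_{k ≤ n} λ(k)/k`, `H(n) = ∑_{m ≤ n} 1/m`, `Q(n) = ∑_{j ≤ ⌊√n⌋} 1/j²` (all over `ℕ`,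
integer division throughout),

* `hyperbola`       : `∑_{m ≤ y} T(⌊y/m⌋)/m = Q(y)` (Dirichlet's rearrangement of `λ * 1 = 𝟙_□`,
                      `Literature.NumberTheory.LFunctions.LiouvilleSum.sum_divisors_liouville`);
* `moebius_sum_eq`  : `∑_{d ≤ D} μ(d) ∑_{m ≤ D/d} F(dm) = F(1)` (Möbius inversion, finite form;
                      `Literature.NumberTheory.Sieve.sum_divisors_moebius_real`);
* `tail_swap`       : `∑_{m₀ < m ≤ y} T(⌊y/m⌋)/m = ∑_{k ≤ y/(m₀+1)} (λ(k)/k)(H(⌊y/k⌋) − H(m₀))`;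
* `main_identity`   : for `1 ≤ D ≤ N`,
  `T(N) = ∑_{d ≤ D} (μ(d)/d) (Q(⌊N/d⌋) − ∑_{k ≤ kmax(d)} (λ(k)/k)(H(⌊N/d/k⌋) − H(⌊D/d⌋)))`,
  `kmax(d) = ⌊⌊N/d⌋/(⌊D/d⌋+1)⌋`.

This is the classical `O(N^{2/3})`-type organisation of such sums (Deléglise–Rivat for `M(x)`); the
evaluator that uses it is `TuranMinWitnessCalc.lean`, its soundness `TuranMinWitnessSound.lean`.

## References

* [BorweinFergusonMossinghoff2008] P. Borwein, R. Ferguson, M. J. Mossinghoff, Math. Comp. 77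
  (2008), 1681–1694, Thm. 1.
* M. Deléglise, J. Rivat, *Computing the summation of the Möbius function*, Experiment. Math. 5
  (1996), 291–295. [folklore]
-/

open Finset ArithmeticFunction
open scoped ArithmeticFunction.Moebius ArithmeticFunction.zeta
open Literature.NumberTheory.LFunctions (LiouvilleSum.abs_liouville_le_one LiouvilleSum.sum_divisors_liouville)

namespace Literature.Barriers.RiemannHypothesis.TuranMinWitness

/-! ## The sums -/

/-- `T(n) = ∑_{1 ≤ k ≤ n} λ(k)/k` for `n : ℕ` (Turán's sum at an integer; this is
`liouvilleHarmonicSum n`). [folklore] -/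
noncomputable def Tn (n : ℕ) : ℝ := ∑ k ∈ Ioc 0 n, (liouville k : ℝ) / k

/-- `H(n) = ∑_{1 ≤ m ≤ n} 1/m`, the harmonic number (as a real). [folklore] -/
noncomputable def Hn (n : ℕ) : ℝ := ∑ m ∈ Ioc 0 n, (1 : ℝ) / m

/-- `Q(n) = ∑_{1 ≤ j ≤ ⌊√n⌋} 1/j²`. [folklore] -/
noncomputable def Qn (n : ℕ) : ℝ := ∑ j ∈ Ioc 0 (Nat.sqrt n), (1 : ℝ) / j ^ 2

/-- `T(0) = 0`. [folklore] -/
@[simp] theorem Tn_zero : Tn 0 = 0 := by simp [Tn]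

/-- `T(n+1) = T(n) + λ(n+1)/(n+1)`. [folklore] -/
theorem Tn_succ (n : ℕ) : Tn (n + 1) = Tn n + (liouville (n + 1) : ℝ) / (n + 1 : ℕ) := by
  unfold Tn; rw [sum_Ioc_succ_top (Nat.zero_le n)]

/-- `H(0) = 0`. [folklore] -/
@[simp] theorem Hn_zero : Hn 0 = 0 := by simp [Hn]

/-- `H(n+1) = H(n) + 1/(n+1)`. [folklore] -/
theorem Hn_succ (n : ℕ) : Hn (n + 1) = Hn n + 1 / (n + 1 : ℕ) := by
  unfold Hn; rw [sum_Ioc_succ_top (Nat.zero_le n)]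

/-- `T(b) − T(a) = ∑_{a < k ≤ b} λ(k)/k` for `a ≤ b`. [folklore] -/
theorem Tn_sub_Tn {a b : ℕ} (h : a ≤ b) :
    Tn b - Tn a = ∑ k ∈ Ioc a b, (liouville k : ℝ) / k := by
  unfold Tn; rw [← sum_Ioc_consecutive _ (Nat.zero_le a) h]; ring

/-- `H(b) − H(a) = ∑_{a < m ≤ b} 1/m` for `a ≤ b`. [folklore] -/
theorem Hn_sub_Hn {a b : ℕ} (h : a ≤ b) : Hn b - Hn a = ∑ m ∈ Ioc a b, (1 : ℝ) / m := by
  unfold Hn; rw [← sum_Ioc_consecutive _ (Nat.zero_le a) h]; ring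

/-- `H` is monotone. [folklore] -/
theorem Hn_mono {a b : ℕ} (h : a ≤ b) : Hn a ≤ Hn b := by
  have := Hn_sub_Hn h
  have h0 : 0 ≤ ∑ m ∈ Ioc a b, (1 : ℝ) / m := sum_nonneg fun m _ => by positivity
  linarith

/-- `0 ≤ H(n)`. [folklore] -/
theorem Hn_nonneg (n : ℕ) : 0 ≤ Hn n := by simpa using Hn_mono (Nat.zero_le n)

/-- `|T(b) − T(a)| ≤ H(b) − H(a)` for `a ≤ b`. [folklore] -/
theorem abs_Tn_sub_Tn_le {a b : ℕ} (h : a ≤ b) : |Tn b - Tn a| ≤ Hn b - Hn a := by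
  rw [Tn_sub_Tn h, Hn_sub_Hn h]
  refine (abs_sum_le_sum_abs _ _).trans (sum_le_sum fun k _ => ?_)
  rw [abs_div, Nat.abs_cast]
  gcongr
  exact LiouvilleSum.abs_liouville_le_one k

/-! ## Dirichlet's hyperbola identity for `λ(k)/k` -/

/-- The arithmetic function `n ↦ 1/n` (value `0` at `0`). [folklore] -/
noncomputable def invAF : ArithmeticFunction ℝ := ⟨fun n => (n : ℝ)⁻¹, by simp⟩

/-- The arithmetic function `n ↦ λ(n)/n`. [folklore] -/
noncomputable def lamDivAF : ArithmeticFunction ℝ := ⟨fun n => (liouville n : ℝ) / n, by simp⟩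

/-- `(1/· * λ/·)(n) = [n = □]/n`. [folklore] -/
theorem invAF_mul_lamDivAF_apply {n : ℕ} (hn : n ≠ 0) :
    (invAF * lamDivAF) n = (if IsSquare n then (1 : ℝ) else 0) / n := by
  rw [mul_apply]
  have h1 : ∀ x ∈ n.divisorsAntidiagonal, invAF x.1 * lamDivAF x.2 = (liouville x.2 : ℝ) / n := by
    intro x hx
    obtain ⟨hx12, -⟩ := Nat.mem_divisorsAntidiagonal.1 hx
    simp only [invAF, lamDivAF, coe_mk]
    rw [← hx12, Nat.cast_mul]
    have h1 : (x.1 : ℝ) ≠ 0 := by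
      have : x.1 ≠ 0 := by rintro h; rw [h, zero_mul] at hx12; exact hn hx12.symm
      exact_mod_cast this
    field_simp
  rw [sum_congr rfl h1, Nat.sum_divisorsAntidiagonal' (fun _ b => (liouville b : ℝ) / n),
    ← sum_div, ← Int.cast_sum, LiouvilleSum.sum_divisors_liouville hn]
  split_ifs <;> simp

/-- `∑_{n ≤ y} [n = □]/n = ∑_{j ≤ ⌊√y⌋} 1/j²`. [folklore] -/
theorem sum_Ioc_ite_isSquare_div (y : ℕ) :
    ∑ n ∈ Ioc 0 y, (if IsSquare n then (1 : ℝ) else 0) / n = Qn y := by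
  rw [Qn]
  have hfilter : ∑ n ∈ Ioc 0 y, (if IsSquare n then (1 : ℝ) else 0) / n =
      ∑ n ∈ (Ioc 0 y).filter IsSquare, (1 : ℝ) / n := by
    rw [sum_filter]
    exact sum_congr rfl fun n _ => by split_ifs <;> simp
  rw [hfilter]
  have himage : (Ioc 0 y).filter IsSquare = (Ioc 0 (Nat.sqrt y)).image fun m => m * m := by
    ext n
    simp only [mem_filter, mem_Ioc, mem_image]
    constructor
    · rintro ⟨⟨hn0, hny⟩, r, rfl⟩
      refine ⟨r, ⟨Nat.pos_of_ne_zero ?_, Nat.le_sqrt.mpr hny⟩, rfl⟩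
      rintro rfl; simp at hn0
    · rintro ⟨m, ⟨hm0, hmy⟩, rfl⟩
      exact ⟨⟨Nat.mul_pos hm0 hm0, Nat.le_sqrt.mp hmy⟩, m, rfl⟩
  rw [himage, sum_image fun a _ b _ h => Nat.mul_self_inj.mp h]
  exact sum_congr rfl fun j _ => by rw [Nat.cast_mul, pow_two]

/-- **Dirichlet's hyperbola identity for `λ(k)/k`.** `∑_{m ≤ y} T(⌊y/m⌋)/m = ∑_{j ≤ √y} 1/j²`.
[folklore] -/
theorem hyperbola (y : ℕ) : ∑ m ∈ Ioc 0 y, Tn (y / m) / m = Qn y := by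
  have h := sum_Ioc_mul_eq_sum_sum invAF lamDivAF y
  have hl : ∑ n ∈ Ioc 0 y, (invAF * lamDivAF) n = Qn y := by
    rw [← sum_Ioc_ite_isSquare_div]
    exact sum_congr rfl fun n hn => invAF_mul_lamDivAF_apply (mem_Ioc.1 hn).1.ne'
  rw [hl] at h
  rw [h]
  refine sum_congr rfl fun m _ => ?_
  simp only [invAF, lamDivAF, coe_mk, Tn]
  rw [div_eq_inv_mul]

/-! ## Möbius inversion over `d ≤ D` -/

/-- **Möbius inversion, finite form.** `∑_{d ≤ D} μ(d) ∑_{m ≤ D/d} F(dm) = F(1)` for `D ≥ 1`.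
[folklore] -/
theorem moebius_sum_eq (F : ℕ → ℝ) {D : ℕ} (hD : 1 ≤ D) :
    ∑ d ∈ Ioc 0 D, (μ d : ℝ) * ∑ m ∈ Ioc 0 (D / d), F (d * m) = F 1 := by
  have h1 : ∑ d ∈ Ioc 0 D, (μ d : ℝ) * ∑ m ∈ Ioc 0 (D / d), F (d * m) =
      ∑ d ∈ Icc 1 D, ∑ m ∈ Icc 1 (D / d), (μ d : ℝ) * F (d * m) := by
    rw [← Finset.Icc_add_one_left_eq_Ioc]
    exact sum_congr rfl fun d _ => by rw [mul_sum, ← Finset.Icc_add_one_left_eq_Ioc]; rfl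
  rw [h1, ← Literature.NumberTheory.Sieve.SquarefreeSums.sum_Icc_sum_divisorsAntidiagonal
    (fun d m => (μ d : ℝ) * F (d * m)) D]
  have h2 : ∀ n ∈ Icc 1 D, ∑ q ∈ n.divisorsAntidiagonal, (μ q.1 : ℝ) * F (q.1 * q.2) =
      if n = 1 then F 1 else 0 := by
    intro n hn
    have h3 : ∀ q ∈ n.divisorsAntidiagonal, (μ q.1 : ℝ) * F (q.1 * q.2) = (μ q.1 : ℝ) * F n :=
      fun q hq => by rw [(Nat.mem_divisorsAntidiagonal.1 hq).1]
    rw [sum_congr rfl h3, ← sum_mul, Nat.sum_divisorsAntidiagonal (fun a _ => (μ a : ℝ)),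
      Literature.NumberTheory.Sieve.sum_divisors_moebius_real]
    split_ifs with h <;> simp [h]
  rw [sum_congr rfl h2, sum_ite_eq']
  simp [hD]

/-! ## The interchange `m ↔ k` in the tail -/

/-- `∑_{m₀ < m ≤ y} T(⌊y/m⌋)/m = ∑_{k ≤ ⌊y/(m₀+1)⌋} (λ(k)/k) (H(⌊y/k⌋) − H(m₀))`. [folklore] -/
theorem tail_swap (y m₀ : ℕ) :
    ∑ m ∈ Ioc m₀ y, Tn (y / m) / m =
      ∑ k ∈ Ioc 0 (y / (m₀ + 1)), (liouville k : ℝ) / k * (Hn (y / k) - Hn m₀) := by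
  have hL : ∑ m ∈ Ioc m₀ y, Tn (y / m) / m =
      ∑ m ∈ Ioc m₀ y, ∑ k ∈ Ioc 0 (y / m), (liouville k : ℝ) / k * (1 / m) := by
    refine sum_congr rfl fun m _ => ?_
    rw [Tn, sum_div]
    exact sum_congr rfl fun k _ => by ring
  have hR : ∑ k ∈ Ioc 0 (y / (m₀ + 1)), (liouville k : ℝ) / k * (Hn (y / k) - Hn m₀) =
      ∑ k ∈ Ioc 0 (y / (m₀ + 1)), ∑ m ∈ Ioc m₀ (y / k), (liouville k : ℝ) / k * (1 / m) := by
    refine sum_congr rfl fun k hk => ?_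
    obtain ⟨hk0, hk⟩ := mem_Ioc.1 hk
    have hm : m₀ ≤ y / k := by
      rw [Nat.le_div_iff_mul_le (Nat.succ_pos m₀)] at hk
      rw [Nat.le_div_iff_mul_le hk0]
      nlinarith
    rw [Hn_sub_Hn hm, mul_sum]
  rw [hL, hR]
  refine sum_comm' fun m k => ?_
  simp only [mem_Ioc]
  constructor
  · rintro ⟨⟨hm0, hmy⟩, hk0, hkm⟩
    have hm1 : 0 < m := by omega
    have hkm' : k * m ≤ y := (Nat.le_div_iff_mul_le hm1).1 hkm
    refine ⟨⟨hm0, ?_⟩, hk0, ?_⟩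
    · rw [Nat.le_div_iff_mul_le hk0, mul_comm]; exact hkm'
    · rw [Nat.le_div_iff_mul_le (Nat.succ_pos m₀)]
      exact le_trans (Nat.mul_le_mul_left k hm0) hkm'
  · rintro ⟨⟨hm0, hmk⟩, hk0, _⟩
    have hmk' : m * k ≤ y := (Nat.le_div_iff_mul_le hk0).1 hmk
    have hm1 : 0 < m := by omega
    refine ⟨⟨hm0, le_trans (Nat.le_mul_of_pos_right m hk0) hmk'⟩, hk0, ?_⟩
    rw [Nat.le_div_iff_mul_le hm1, mul_comm]; exact hmk'

/-! ## The main identity -/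

/-- **The evaluation formula.** For `1 ≤ D ≤ N`:
`T(N) = ∑_{d ≤ D} (μ(d)/d) · (Q(⌊N/d⌋) − ∑_{k ≤ kmax(d)} (λ(k)/k)(H(⌊⌊N/d⌋/k⌋) − H(⌊D/d⌋)))`,
`kmax(d) = ⌊⌊N/d⌋/(⌊D/d⌋+1)⌋`. [folklore] -/
theorem main_identity {N D : ℕ} (hD : 1 ≤ D) (hDN : D ≤ N) :
    Tn N = ∑ d ∈ Ioc 0 D, (μ d : ℝ) / d *
      (Qn (N / d) - ∑ k ∈ Ioc 0 (N / d / (D / d + 1)),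
        (liouville k : ℝ) / k * (Hn (N / d / k) - Hn (D / d))) := by
  have h := moebius_sum_eq (fun e => Tn (N / e) / e) hD
  simp only [Nat.cast_one, div_one, Nat.div_one] at h
  rw [← h]
  refine sum_congr rfl fun d hd => ?_
  obtain ⟨hd0, hdD⟩ := mem_Ioc.1 hd
  set y := N / d with hy
  set m₀ := D / d with hm₀
  have hm₀y : m₀ ≤ y := Nat.div_le_div_right hDN
  -- the hyperbola identity at `y`, split at `m₀`
  have hsplit : Qn y = ∑ m ∈ Ioc 0 m₀, Tn (y / m) / m + ∑ m ∈ Ioc m₀ y, Tn (y / m) / m := by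
    rw [← hyperbola y, sum_Ioc_consecutive _ (Nat.zero_le _) hm₀y]
  have hA : ∑ m ∈ Ioc 0 m₀, Tn (N / (d * m)) / ((d * m : ℕ) : ℝ) =
      (1 / d) * ∑ m ∈ Ioc 0 m₀, Tn (y / m) / m := by
    rw [mul_sum]
    refine sum_congr rfl fun m _ => ?_
    rw [hy, Nat.div_div_eq_div_mul, Nat.cast_mul]
    have hd' : (d : ℝ) ≠ 0 := by exact_mod_cast hd0.ne'
    field_simp
  rw [hA, hsplit, tail_swap y m₀]
  ring

end Literature.Barriers.RiemannHypothesis.TuranMinWitness
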